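import Literature.MathematicalPhysics.QuantumLattice.SusyTJLadderBookkeeping
import Literature.MathematicalPhysics.QuantumLattice.HubbardHubbardModelEtaODLROProofs
import HarnessLib

/-!
# The supersymmetric `t`-`J` bond identity on the Gutzwiller space (Sarkar 1991; Essler–Korepin 1992)

Topic `Literature/MathematicalPhysics/QuantumLattice` (sub-namespace `SusyTJ`). Written for route
`HubbardSuperconductivity/HyperoctahedralMott`, support `SusyInterchangeIdentity`
(stmt-HubbardSuperconductivity-6675); the summed identity closing that item lives in
`Summits/…/Theorems/HyperoctahedralMottSusyInterchangeIdentity.lean`.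

For a finite graph `G`, hopping `t`, the Gutzwiller projector `P = gutzwillerProj`, the bond
singlet-pair operator `B_{xy} = c_{x↑}c_{y↓} - c_{x↓}c_{y↑}`, the graded site swap
`π(xy) = Π_σ [1 - (c†_{xσ} - c†_{yσ})(c_{xσ} - c_{yσ})]` (the tree's `siteSwap`, here inlined as
in the route file) and `n^s_x = n_{x↑} + n_{x↓} - 2 n_{x↑} n_{x↓}`:

  `P [hamiltonian G t 0 - (t/2) Σ_{x,y adj} B_{xy}†B_{xy}] P
     = P [-(t/2) Σ_{x,y adj} π(xy) - t Σ_x deg(x) (n^s_x - ½)] P`,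

i.e. the `t`-`J` Hamiltonian at its supersymmetric point `J = 2t` is, on the Gutzwiller space, a
sum of graded transpositions plus chemical-potential terms (Sarkar 1991; Essler–Korepin 1992).

* `gutzwillerProj_mul_doublon`, `doublon_mul_gutzwillerProj` — `P` kills a doublon on either side;
* `pairDensity_normal_form` — `B†B = n_{x↑}n_{y↓} + n_{y↑}n_{x↓} + (c†_{x↑}c_{y↑})(c†_{y↓}c_{x↓}) + (c†_{y↑}c_{x↑})(c†_{x↓}c_{y↓})`;
* `gutzwiller_bond_identity` — the bond-local identity `P (T + B†B) P = P (π + n^s_x + n^s_y - 1) P`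
  for `x ≠ y` (free identity `susy_free_identity` + doublon absorption);
* `sum_adj_eq_of_symm_eq`, `degree_smul_eq_sum_adj` — symmetrisation of ordered-edge sums;

No definitions. Sources: S. Sarkar, J. Phys. A 24 (1991) 1137 (eqs. (2)–(4));
F. Essler, V. Korepin, Phys. Rev. B 46 (1992) 9147.
-/

namespace Literature.MathematicalPhysics.QuantumLattice.SusyTJ

open Matrix Finset Literature.MathematicalPhysics.QuantumLattice HubbardWave0

section Bond

variable {Λ : Type*} [LinearOrder Λ] [Fintype Λ]

/-- The Gutzwiller projector kills a doublon on the left: `P · n_{x↑} n_{x↓} = 0`. [folklore] -/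
theorem gutzwillerProj_mul_doublon (x : Λ) :
    gutzwillerProj * (numberOp x 0 * numberOp x 1) = (0 : Matrix (Finset (Orb Λ)) (Finset (Orb Λ)) ℂ) := by
  rw [gutzwillerProj, numberOp_mul_numberOp_eq_diagonal, diagonal_mul_diagonal, ← diagonal_zero]
  congr 1
  funext s
  by_cases h : HasDoubleOccupancy s
  · rw [if_pos h, zero_mul]
  · have h' : ¬ (orb x 0 ∈ s ∧ orb x 1 ∈ s) := fun hx => h ⟨x, hx.1, hx.2⟩
    rw [if_neg h, if_neg h', mul_zero]

/-- The Gutzwiller projector kills a doublon on the right: `n_{x↑} n_{x↓} · P = 0`. [folklore] -/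
theorem doublon_mul_gutzwillerProj (x : Λ) :
    numberOp x 0 * numberOp x 1 * gutzwillerProj = (0 : Matrix (Finset (Orb Λ)) (Finset (Orb Λ)) ℂ) := by
  rw [gutzwillerProj, numberOp_mul_numberOp_eq_diagonal, diagonal_mul_diagonal, ← diagonal_zero]
  congr 1
  funext s
  by_cases h : HasDoubleOccupancy s
  · rw [if_pos h, mul_zero]
  · have h' : ¬ (orb x 0 ∈ s ∧ orb x 1 ∈ s) := fun hx => h ⟨x, hx.1, hx.2⟩
    rw [if_neg h, if_neg h', zero_mul]

/-- **Normal form of the singlet-pair density** `B†B` on a bond, `B = c_{x↑}c_{y↓} - c_{x↓}c_{y↑}`: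
`B†B = n_{x↑} n_{y↓} + n_{y↑} n_{x↓} + (c†_{x↑}c_{y↑})(c†_{y↓}c_{x↓}) + (c†_{y↑}c_{x↑})(c†_{x↓}c_{y↓})`
(the last two terms are `-S⁺_x S⁻_y - S⁻_x S⁺_y`). [folklore] -/
theorem pairDensity_normal_form {x y : Λ} (hxy : x ≠ y) :
    (creation (orb y 1) * creation (orb x 0) - creation (orb y 0) * creation (orb x 1)) *
        (annihilation (orb x 0) * annihilation (orb y 1) -
          annihilation (orb x 1) * annihilation (orb y 0)) =
      creation (orb x 0) * annihilation (orb x 0) * (creation (orb y 1) * annihilation (orb y 1)) +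
        creation (orb y 0) * annihilation (orb y 0) * (creation (orb x 1) * annihilation (orb x 1)) +
        creation (orb x 0) * annihilation (orb y 0) * (creation (orb y 1) * annihilation (orb x 1)) +
        creation (orb y 0) * annihilation (orb x 0) * (creation (orb x 1) * annihilation (orb y 1)) := by
  set A0 := creation (orb x 0) with hA0
  set A1 := creation (orb x 1) with hA1
  set B0 := creation (orb y 0) with hB0
  set B1 := creation (orb y 1) with hB1
  set a0 := annihilation (orb x 0) with ha0
  set a1 := annihilation (orb x 1) with ha1
  set b0 := annihilation (orb y 0) with hb0
  set b1 := annihilation (orb y 1) with hb1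
  have hx01 : orb x 0 ≠ orb x 1 := EtaPairingODLRO.orb_zero_ne_orb_one x
  have hy01 : orb y 0 ≠ orb y 1 := EtaPairingODLRO.orb_zero_ne_orb_one y
  have hxy := fun (σ τ : Fin 2) => EtaPairingODLRO.orb_ne_orb_of_ne hxy σ τ
  -- the four monomials of the expansion, normal ordered
  have m1 : B1 * A0 * a0 * b1 = A0 * a0 * (B1 * b1) := by
    have h : B1 * (A0 * a0) = A0 * a0 * B1 :=
      ladder_mul_bilinear_comm (Or.inl hB1) (Or.inl hA0) (Or.inr ha0) (hxy 0 1).symm (hxy 0 1).symm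
    rw [mul_assoc B1, h, mul_assoc]
  have m2 : B1 * A0 * a1 * b0 = -(A0 * b0 * (B1 * a1)) := by
    have h : B1 * A0 = -(A0 * B1) := creation_mul_creation_eq_neg _ _
    have h' : b0 * (B1 * a1) = B1 * a1 * b0 :=
      ladder_mul_bilinear_comm (Or.inr hb0) (Or.inl hB1) (Or.inr ha1) hy01 (hxy 1 0).symm
    rw [h, neg_mul, neg_mul, mul_assoc A0 b0, h']
    simp only [mul_assoc]
  have m3 : B0 * A1 * a0 * b1 = -(B0 * a0 * (A1 * b1)) := by
    have h : A1 * a0 = -(a0 * A1) := creation_mul_annihilation_of_ne hx01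
    rw [mul_assoc B0, h, mul_neg, neg_mul]
    simp only [mul_assoc]
  have m4 : B0 * A1 * a1 * b0 = B0 * b0 * (A1 * a1) := by
    have h' : b0 * (A1 * a1) = A1 * a1 * b0 :=
      ladder_mul_bilinear_comm (Or.inr hb0) (Or.inl hA1) (Or.inr ha1) (hxy 1 0).symm (hxy 1 0).symm
    rw [mul_assoc B0 b0, h']
    simp only [mul_assoc]
  calc (B1 * A0 - B0 * A1) * (a0 * b1 - a1 * b0)
      = B1 * A0 * a0 * b1 - B1 * A0 * a1 * b0 - B0 * A1 * a0 * b1 + B0 * A1 * a1 * b0 := by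
        noncomm_ring
    _ = _ := by rw [m1, m2, m3, m4]; noncomm_ring


/-- **The bond-local supersymmetric interchange identity.** For two distinct sites `x ≠ y`, with
`T = Σ_σ (c†_{xσ}c_{yσ} + c†_{yσ}c_{xσ})`, `B = c_{x↑}c_{y↓} - c_{x↓}c_{y↑}`, the graded site swap
`Sw = Π_σ [1 - (c†_{xσ} - c†_{yσ})(c_{xσ} - c_{yσ})]`, `n^s_z = n_{z↑} + n_{z↓} - 2 n_{z↑}n_{z↓}` and
the Gutzwiller projector `P`:  `P (T + B†B) P = P (Sw + n^s_x + n^s_y - 1) P`.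
Proof: after normal-ordering `B†B` (`pairDensity_normal_form`) the difference of the two inner
operators is, as a FREE noncommutative polynomial in the eight ladder operators, a sum of twelve
monomials each of which either contains a doublon `n_{z↑}n_{z↓}` or is absorbed by one on the side
facing `P` (`doublon_absorb₁…₅`), hence is killed by `P` (`gutzwillerProj_mul_doublon`).
[cite: Sarkar1991, eq. (2)–(4) (supersymmetric t-J model as graded permutations)] -/
theorem gutzwiller_bond_identity {x y : Λ} (hxy : x ≠ y) :
    gutzwillerProj *
        ((∑ σ : Fin 2, (creation (orb x σ) * annihilation (orb y σ) +
            creation (orb y σ) * annihilation (orb x σ))) +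
          (annihilation (orb x 0) * annihilation (orb y 1) -
              annihilation (orb x 1) * annihilation (orb y 0))ᴴ *
            (annihilation (orb x 0) * annihilation (orb y 1) -
              annihilation (orb x 1) * annihilation (orb y 0))) *
      gutzwillerProj =
    gutzwillerProj *
        ((1 - (creation (orb x 0) - creation (orb y 0)) *
              (annihilation (orb x 0) - annihilation (orb y 0))) *
            (1 - (creation (orb x 1) - creation (orb y 1)) *
              (annihilation (orb x 1) - annihilation (orb y 1))) +
          (numberOp x 0 + numberOp x 1 - (2 : ℂ) • (numberOp x 0 * numberOp x 1)) +
          (numberOp y 0 + numberOp y 1 - (2 : ℂ) • (numberOp y 0 * numberOp y 1)) - 1) *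
      gutzwillerProj := by
  have hconj : (annihilation (orb x 0) * annihilation (orb y 1) -
      annihilation (orb x 1) * annihilation (orb y 0))ᴴ =
      creation (orb y 1) * creation (orb x 0) - creation (orb y 0) * creation (orb x 1) := by
    rw [conjTranspose_sub, conjTranspose_mul, conjTranspose_mul]; rfl
  rw [Fin.sum_univ_two, hconj, pairDensity_normal_form hxy, two_smul, two_smul]
  simp only [numberOp]
  -- the Gutzwiller projector kills doublons
  have hPDx := gutzwillerProj_mul_doublon x
  have hDxP := doublon_mul_gutzwillerProj x
  have hPDy := gutzwillerProj_mul_doublon y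
  have hDyP := doublon_mul_gutzwillerProj y
  simp only [numberOp] at hPDx hDxP hPDy hDyP
  set P : Matrix (Finset (Orb Λ)) (Finset (Orb Λ)) ℂ := gutzwillerProj with hP
  set A0 := creation (orb x 0) with hA0
  set A1 := creation (orb x 1) with hA1
  set B0 := creation (orb y 0) with hB0
  set B1 := creation (orb y 1) with hB1
  set a0 := annihilation (orb x 0) with ha0
  set a1 := annihilation (orb x 1) with ha1
  set b0 := annihilation (orb y 0) with hb0
  set b1 := annihilation (orb y 1) with hb1
  have hx01 : orb x 0 ≠ orb x 1 := EtaPairingODLRO.orb_zero_ne_orb_one x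
  have hy01 : orb y 0 ≠ orb y 1 := EtaPairingODLRO.orb_zero_ne_orb_one y
  have hxy' := fun (σ τ : Fin 2) => EtaPairingODLRO.orb_ne_orb_of_ne hxy σ τ
  -- the difference of the inner operators, as a free polynomial
  have hΔ := susy_free_identity A0 A1 B0 B1 a0 a1 b0 b1
  -- the twelve monomials of the difference are killed by the sandwich
  have k1 : P * (A0 * a0 * (A1 * a1)) * P = 0 := by rw [hPDx, zero_mul]
  have k2 : P * (B0 * b0 * (B1 * b1)) * P = 0 := by rw [hPDy, zero_mul]
  have k3 : P * (A0 * a0 * (A1 * b1)) * P = 0 :=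
    sandwich_eq_zero_of_left hPDx (doublon_absorb₁ _ _ b1)
  have k4 : P * (A0 * a0 * (B1 * a1)) * P = 0 :=
    sandwich_eq_zero_of_right hDxP (doublon_absorb₂ hx01 (hxy' 0 1).symm (Or.inl hB1))
  have k5 : P * (B0 * b0 * (A1 * b1)) * P = 0 :=
    sandwich_eq_zero_of_right hDyP (doublon_absorb₂ hy01 (hxy' 1 0) (Or.inl hA1))
  have k6 : P * (B0 * b0 * (B1 * a1)) * P = 0 :=
    sandwich_eq_zero_of_left hPDy (doublon_absorb₁ _ _ a1)
  have k7 : P * (A0 * b0 * (A1 * a1)) * P = 0 :=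
    sandwich_eq_zero_of_left hPDx (doublon_absorb₃ hx01 (hxy' 1 0).symm (Or.inr hb0))
  have k8 : P * (A0 * b0 * (B1 * b1)) * P = 0 :=
    sandwich_eq_zero_of_right hDyP (doublon_absorb₄ _ _ A0)
  have k9 : P * (B0 * a0 * (A1 * a1)) * P = 0 :=
    sandwich_eq_zero_of_right hDxP (doublon_absorb₄ _ _ B0)
  have k10 : P * (B0 * a0 * (B1 * b1)) * P = 0 :=
    sandwich_eq_zero_of_left hPDy (doublon_absorb₃ hy01 (hxy' 0 1) (Or.inr ha0))
  have k11 : P * (A0 * b0 * (A1 * b1)) * P = 0 := by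
    have h : A0 * b0 * (A1 * b1) = -(A0 * A1 * (b0 * b1)) := by
      rw [mul_assoc A0 b0, ← mul_assoc b0, annihilation_mul_creation_of_ne (hxy' 1 0).symm]
      noncomm_ring
    rw [h, mul_neg, neg_mul, sandwich_eq_zero_of_left hPDx (doublon_absorb₅ hx01 (b0 * b1)), neg_zero]
  have k12 : P * (B0 * a0 * (B1 * a1)) * P = 0 := by
    have h : B0 * a0 * (B1 * a1) = -(B0 * B1 * (a0 * a1)) := by
      rw [mul_assoc B0 a0, ← mul_assoc a0, annihilation_mul_creation_of_ne (hxy' 0 1)]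
      noncomm_ring
    rw [h, mul_neg, neg_mul, sandwich_eq_zero_of_left hPDy (doublon_absorb₅ hy01 (a0 * a1)), neg_zero]
  rw [hΔ, mul_add P, add_mul _ _ P]
  have hΔP : P * (A0 * a0 * (A1 * a1) + B0 * b0 * (B1 * b1) +
          (A0 * a0 + B0 * b0) * (A1 * b1 + B1 * a1) + (A0 * b0 + B0 * a0) * (A1 * a1 + B1 * b1) -
          A0 * b0 * (A1 * b1) - B0 * a0 * (B1 * a1)) * P = 0 := by
    simp only [mul_add, add_mul, mul_sub, sub_mul]
    rw [k1, k2, k3, k4, k5, k6, k7, k8, k9, k10, k11, k12]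
    abel
  rw [hΔP, add_zero]

end Bond

section Assembly

variable {Λ : Type*} [LinearOrder Λ] [Fintype Λ]

omit [LinearOrder Λ] in
/-- Symmetrisation of a double sum over the ordered edges of a simple graph: two edge functions
whose symmetrised values agree on every edge have the same sum. [folklore] -/
theorem sum_adj_eq_of_symm_eq {M : Type*} [AddCommGroup M] [Module ℂ M] (G : SimpleGraph Λ)
    [DecidableRel G.Adj] (f g : Λ → Λ → M)
    (h : ∀ x y, G.Adj x y → f x y + f y x = g x y + g y x) :
    (∑ x, ∑ y, if G.Adj x y then f x y else 0) = ∑ x, ∑ y, if G.Adj x y then g x y else 0 := by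
  have swap : ∀ k : Λ → Λ → M, (∑ x, ∑ y, if G.Adj x y then k x y else 0) =
      ∑ x, ∑ y, if G.Adj x y then k y x else 0 := by
    intro k
    rw [Finset.sum_comm]
    exact Finset.sum_congr rfl fun x _ => Finset.sum_congr rfl fun y _ =>
      if_congr (G.adj_comm y x) rfl rfl
  have double : ∀ k : Λ → Λ → M, (∑ x, ∑ y, if G.Adj x y then k x y else 0) =
      (1 / 2 : ℂ) • ∑ x, ∑ y, if G.Adj x y then k x y + k y x else 0 := by
    intro k
    have h2 : (∑ x, ∑ y, if G.Adj x y then k x y + k y x else 0) =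
        (∑ x, ∑ y, if G.Adj x y then k x y else 0) + ∑ x, ∑ y, if G.Adj x y then k y x else 0 := by
      rw [← Finset.sum_add_distrib]
      refine Finset.sum_congr rfl fun x _ => ?_
      rw [← Finset.sum_add_distrib]
      refine Finset.sum_congr rfl fun y _ => ?_
      rw [ite_add_ite, add_zero]
    rw [h2, ← swap k, ← two_smul ℂ, smul_smul]
    norm_num
  rw [double f, double g]
  congr 1
  refine Finset.sum_congr rfl fun x _ => Finset.sum_congr rfl fun y _ => ?_
  by_cases hxy : G.Adj x y
  · rw [if_pos hxy, if_pos hxy, h x y hxy]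
  · rw [if_neg hxy, if_neg hxy]

omit [LinearOrder Λ] in
/-- The degree-weighted site sum as a sum over ordered edges:
`deg(x) • M = Σ_y [x ~ y] M`. [folklore] -/
theorem degree_smul_eq_sum_adj {M : Type*} [AddCommGroup M] [Module ℂ M] (G : SimpleGraph Λ)
    [DecidableRel G.Adj] (x : Λ) (m : M) :
    ((G.degree x : ℕ) : ℂ) • m = ∑ y, if G.Adj x y then m else 0 := by
  rw [Finset.sum_ite, Finset.sum_const_zero, add_zero, Finset.sum_const, Nat.cast_smul_eq_nsmul,
    ← SimpleGraph.card_neighborFinset_eq_degree, SimpleGraph.neighborFinset_eq_filter]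

end Assembly

end Literature.MathematicalPhysics.QuantumLattice.SusyTJ
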